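import Literature.MathematicalPhysics.StatisticalMechanics.ComplexSpinChiralLROHighDimension
import Mathlib.Analysis.SpecialFunctions.Integrals.Basic
import HarnessLib

/-!
# The fluctuation constant vanishes in high dimension: Salmhofer–Seiler's Prop. 4.2 (3) and
# Theorem 4.8 as printed (CMP 139 (1991), Prop. 4.2 (3), Lemma A.7, (A.59), Thm. 4.8)

Fifteenth file of the Salmhofer–Seiler series; theorems only (no definition, no named fact).
`ComplexSpinFluctuationBound` proves (A.2)–(A.3) in the form
`S(ν) = νR(ν) - (2π)^{-ν}∫_{[-π,π]^ν} h_ν(D)` (`fluctS_eq`, `h_ν(D) = ν/max(ν, D) = compTerm ν D`,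
`D = ∑_μ(1 - cos k_μ)`; in the print's notation `(2π)^{-ν}∫h_ν = ½ + νR₋(ν)`), and Thm. 4.8 in the
form "`2S(ν)K(N)/N < 1` ⇒ chiral LRO at `m = 0`, uniformly in the even volume"
(`chiralLRO_of_fluctS_lt`); `LatticeGreenOriginBound` proves `R(ν) ≤ 1/(ν - 2)` (A.23).  The
printed Thm. 4.8 — "there is a `ν₀ ≥ 3` so that long-range order holds at `m = 0` for all `ν ≥ ν₀`",
for EVERY interaction with `w_k ≥ 0`, `w₁ = 1` — needs `S(ν) → 0` (Prop. 4.2 (3)), which the tree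
did not have: the analytic bound `S(ν) ≤ ν/(ν-2) - 3/4 → 1/4` of `ComplexSpinChiralLROHighDimension`
only serves interactions with `K(N)/N < 2`.  PROVED here:

* `one_sub_avgCompTerm_le_eps`, `one_sub_avgCompTerm_le` — **Lemma A.7 with a better rate and no
  Bessel functions**: `0 ≤ 1 - (2π)^{-ν}∫ h_ν(D) ≤ 1/√(2ν)` (printed: `u(ν)/2`, `u(ν) ≤ c(ν₀)ν^{-1/4}`
  (A.37), via `J₀`/`Si` asymptotics (A.38)–(A.58)).  Proof: pointwise
  `1 - h_ν(D) = (1 - ν/D)⁺ ≤ (D - ν)⁺/ν ≤ ε + (D - ν)²/(4εν²)` (AM–GM), and the second moment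
  `(2π)^{-ν}∫(D - ν)² d^νk = ν/2` (the `cos k_μ` are orthogonal with `∫cos² = π`; Fubini over the
  coordinates); then `ε = 1/(2√(2ν))`;
* `avgCompTerm_le_one`, `tendsto_avgCompTerm` — `(2π)^{-ν}∫ h_ν(D) → 1` (Lemma A.7: "the upper
  bound in (A.6) becomes exact as `ν → ∞`");
* `fluctS_le_sub_one_add`, **`fluctS_le_rate`** — **Prop. 4.2 (3), quantitative:
  `0 ≤ S(ν) ≤ 2/(ν - 2) + 1/√(2ν)`** (`ν ≥ 3`; the printed (A.59) is
  `S(ν) ≤ ν/(ν-2) - 1 + u(ν)/2`); **`tendsto_fluctS`** — `S(ν) → 0`;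
* **`chiralLRO_exists_dim`** — **Theorem 4.8 as printed**: for `B = exp(NW)` to order `N` with
  `w₁ = 1`, `w_k ≥ 0`, there is `ν₀ ≥ 3` such that for every `ν ≥ ν₀` there are `c > 0`, `L₀` with
  `|Λ|⁻¹∑_x⟨σ_0σ_x⟩_Λ ≥ c` for all even `L ≥ L₀`.

Honest framing: `β = 0` complex spin systems (Salmhofer–Seiler's bosonised one-link integrals) on
even tori, `m = 0`; the infinite-volume LRO statement (Thm. 3.23, `c₀ > 0`) is represented by its
uniform finite-volume content, as everywhere in this series; nothing about `β > 0`, the continuum,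
`SU(N)` or the summit's `QCD` conjunct.

## References

* M. Salmhofer, E. Seiler, Commun. Math. Phys. 139 (1991) 395–432: (4.1), Prop. 4.2 (3) (4.5),
  Thm. 4.8, Appendix (A.2)–(A.6), Lemma A.4 (A.23), Lemma A.7 (A.36)–(A.37), (A.59).
  [SalmhoferSeiler1991]

## Mathlib

`MeasureTheory.integral_fintype_prod_eq_prod` (Fubini over the coordinates of `[-π,π]^ν`, with the
tree's `volume_restrict_brillouin`), `integral_cos`, `integral_cos_sq`, `Filter.Tendsto.div_atTop`,
`Real.tendsto_sqrt_atTop`, `tendsto_of_tendsto_of_tendsto_of_le_of_le'`.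
-/

noncomputable section

open MeasureTheory Set Filter Finset Real
open Literature.Probability.LatticeModels

namespace Literature.MathematicalPhysics.StatisticalMechanics

namespace ComplexSpin

variable {ν : ℕ}

/-! ### Second moment of `C(k) = ∑_μ cos k_μ` over the Brillouin zone: `(2π)^{-ν}∫ C² = ν/2` -/

/-- Fubini for product integrands over `[-π,π]^ν`. [folklore] -/
private theorem integral_brillouin_prod (f : Fin ν → ℝ → ℝ) :
    ∫ p in brillouin ν, ∏ i, f i (p i) = ∏ i, ∫ t in Icc (-π) π, f i t := by
  rw [volume_restrict_brillouin, integral_fintype_prod_eq_prod]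

/-- `∫_{-π}^{π} 1 = 2π`. [folklore] -/
private theorem integral_Icc_one : ∫ _t in Icc (-π) π, (1 : ℝ) = 2 * π := by
  rw [setIntegral_const, Real.volume_real_Icc_of_le (by linarith [Real.pi_pos]), smul_eq_mul,
    mul_one]
  ring

/-- `∫_{-π}^{π} cos = 0`. [folklore] -/
private theorem integral_Icc_cos : ∫ t in Icc (-π) π, Real.cos t = 0 := by
  rw [integral_Icc_eq_integral_Ioc, ← intervalIntegral.integral_of_le (by linarith [Real.pi_pos]),
    integral_cos]
  simp

/-- `∫_{-π}^{π} cos² = π`. [folklore] -/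
private theorem integral_Icc_cos_sq : ∫ t in Icc (-π) π, Real.cos t ^ 2 = π := by
  rw [integral_Icc_eq_integral_Ioc, ← intervalIntegral.integral_of_le (by linarith [Real.pi_pos]),
    integral_cos_sq]
  simp [Real.sin_pi, Real.cos_pi]

/-- Cross terms vanish: `∫ cos k_μ cos k_{μ'} = 0` for `μ ≠ μ'`. [folklore] -/
private theorem integral_brillouin_cos_mul_cos_of_ne {μ μ' : Fin ν} (h : μ ≠ μ') :
    ∫ p in brillouin ν, Real.cos (p μ) * Real.cos (p μ') = 0 := by
  classical
  have hf : (fun p : Fin ν → ℝ => Real.cos (p μ) * Real.cos (p μ')) =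
      fun p => ∏ i, ((if i = μ then Real.cos (p i) else 1) * (if i = μ' then Real.cos (p i) else 1)) := by
    funext p
    rw [Finset.prod_mul_distrib, Fintype.prod_ite_eq', Fintype.prod_ite_eq']
  rw [hf, integral_brillouin_prod
    (fun i t => (if i = μ then Real.cos t else 1) * (if i = μ' then Real.cos t else 1))]
  refine Finset.prod_eq_zero (Finset.mem_univ μ) ?_
  simp only [if_neg h, mul_one]
  exact integral_Icc_cos

/-- Diagonal terms: `∫ cos² k_μ = π (2π)^{ν-1}`. [folklore] -/
private theorem integral_brillouin_cos_sq (μ : Fin ν) :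
    ∫ p in brillouin ν, Real.cos (p μ) * Real.cos (p μ) = π * (2 * π) ^ (ν - 1) := by
  classical
  have hf : (fun p : Fin ν → ℝ => Real.cos (p μ) * Real.cos (p μ)) =
      fun p => ∏ i, (if i = μ then Real.cos (p i) ^ 2 else 1) := by
    funext p
    rw [Fintype.prod_ite_eq', sq]
  rw [hf, integral_brillouin_prod (fun i t => if i = μ then Real.cos t ^ 2 else 1)]
  have hi : ∀ i : Fin ν, (∫ t in Icc (-π) π, (fun i t => if i = μ then Real.cos t ^ 2 else (1 : ℝ)) i t) =
      if i = μ then π else 2 * π := by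
    intro i
    split_ifs with hiμ
    · simp only [hiμ, if_true]; exact integral_Icc_cos_sq
    · simp only [hiμ, if_false]; exact integral_Icc_one
  simp_rw [hi]
  rw [← Finset.mul_prod_erase Finset.univ _ (Finset.mem_univ μ), if_pos rfl]
  congr 1
  rw [Finset.prod_congr rfl fun i hi => by rw [if_neg (Finset.ne_of_mem_erase hi)],
    Finset.prod_const, Finset.card_erase_of_mem (Finset.mem_univ μ), Finset.card_univ,
    Fintype.card_fin]

/-- **`(2π)^{-ν}∫_{[-π,π]^ν} C(k)² d^νk = ν/2`**, `C(k) = ∑_μ cos k_μ` (the `cos k_μ` are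
"independent, mean zero, variance `½`"). [folklore] -/
private theorem integral_brillouin_cosSum_sq :
    ∫ p in brillouin ν, (∑ μ, Real.cos (p μ)) ^ 2 = (ν : ℝ) / 2 * (2 * π) ^ ν := by
  classical
  have hexp : (fun p : Fin ν → ℝ => (∑ μ, Real.cos (p μ)) ^ 2) =
      fun p => ∑ μ, ∑ μ', Real.cos (p μ) * Real.cos (p μ') := by
    funext p
    rw [sq, Finset.sum_mul_sum]
  have hint : ∀ μ μ' : Fin ν, Integrable (fun p : Fin ν → ℝ => Real.cos (p μ) * Real.cos (p μ'))
      (volume.restrict (brillouin ν)) := fun μ μ' =>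
    (by fun_prop : Continuous fun p : Fin ν → ℝ =>
      Real.cos (p μ) * Real.cos (p μ')).continuousOn.integrableOn_compact (isCompact_brillouin ν)
  rw [hexp, integral_finsetSum _ (fun μ _ => integrable_finsetSum _ fun μ' _ => hint μ μ')]
  simp_rw [integral_finsetSum _ (fun μ' _ => hint _ μ')]
  have hinner : ∀ μ : Fin ν, ∑ μ', ∫ p in brillouin ν, Real.cos (p μ) * Real.cos (p μ') =
      π * (2 * π) ^ (ν - 1) := by
    intro μ
    rw [Finset.sum_eq_single μ]
    · exact integral_brillouin_cos_sq μ
    · intro μ' _ hne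
      exact integral_brillouin_cos_mul_cos_of_ne (Ne.symm hne)
    · intro h; exact absurd (Finset.mem_univ μ) h
  simp_rw [hinner]
  rw [Finset.sum_const, Finset.card_univ, Fintype.card_fin, nsmul_eq_mul]
  rcases Nat.eq_zero_or_pos ν with rfl | hν
  · simp
  · obtain ⟨n, rfl⟩ : ∃ n, ν = n + 1 := ⟨ν - 1, by omega⟩
    rw [Nat.add_sub_cancel, pow_succ]
    push_cast
    ring

/-- `(D(k) - ν)² = C(k)²` with `D = ∑_μ(1 - cos k_μ) = ν - C`. [cite: SalmhoferSeiler1991, (4.1)] -/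
private theorem dispersion_sub_eq (p : Fin ν → ℝ) :
    dispersion p - ν = -∑ μ, Real.cos (p μ) := by
  unfold dispersion
  rw [Finset.sum_sub_distrib, Finset.sum_const, Finset.card_univ, Fintype.card_fin, nsmul_eq_mul,
    mul_one]
  ring

/-- `(2π)^{-ν}∫ (D - ν)² = ν/2` (the variance of `D` under the uniform measure on the zone).
[folklore] -/
private theorem integral_brillouin_dispersion_sub_sq :
    ∫ p in brillouin ν, (dispersion p - ν) ^ 2 = (ν : ℝ) / 2 * (2 * π) ^ ν := by
  simp_rw [dispersion_sub_eq, neg_sq]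
  exact integral_brillouin_cosSum_sq

/-! ### Lemma A.7 without Bessel functions: `1 - (2π)^{-ν}∫ h_ν(D) ≤ 1/√(2ν)` -/

/-- Pointwise: `1 - h_ν(D) = (1 - ν/D)⁺ ≤ (D - ν)⁺/ν ≤ ε + (D - ν)²/(4εν²)` for every `ε > 0`
(`h_ν(D) = ν/max(ν, D)`; AM–GM). [folklore] -/
private theorem one_sub_compTerm_le (hν : 1 ≤ ν) {ε : ℝ} (hε : 0 < ε) (D : ℝ) :
    1 - compTerm ν D ≤ ε + (D - ν) ^ 2 / (4 * ε * (ν : ℝ) ^ 2) := by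
  have hν' : (0 : ℝ) < ν := by exact_mod_cast hν
  have hsq : 0 ≤ (D - ν) ^ 2 / (4 * ε * (ν : ℝ) ^ 2) := by positivity
  unfold compTerm
  rcases le_or_gt D ν with h | h
  · rw [max_eq_left h, div_self hν'.ne']
    linarith
  · rw [max_eq_right h.le]
    have hD : 0 < D := lt_trans hν' h
    have h1 : 1 - (ν : ℝ) / D ≤ (D - ν) / ν := by
      rw [one_sub_div hD.ne']
      exact div_le_div_of_nonneg_left (by linarith) hν' h.le
    have h2 : (D - ν) / ν ≤ ε + (D - ν) ^ 2 / (4 * ε * (ν : ℝ) ^ 2) := by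
      have hkey : ε + (D - ν) ^ 2 / (4 * ε * (ν : ℝ) ^ 2) - (D - ν) / ν =
          ((D - ν) / ν - 2 * ε) ^ 2 / (4 * ε) := by
        field_simp
        ring
      have : 0 ≤ ((D - ν) / ν - 2 * ε) ^ 2 / (4 * ε) := by positivity
      linarith
    linarith

/-- `∫_{[-π,π]^ν} 1 = (2π)^ν`. [folklore] -/
private theorem integral_brillouin_one : ∫ _p in brillouin ν, (1 : ℝ) = (2 * π) ^ ν := by
  have h := integral_brillouin_prod (ν := ν) (fun _ _ => (1 : ℝ))
  simp only [Finset.prod_const_one] at h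
  rw [h, integral_Icc_one, Finset.prod_const, Finset.card_univ, Fintype.card_fin]

/-- `p ↦ h_ν(D(p))` is continuous (`max(ν, D) ≥ ν > 0`). [folklore] -/
private theorem continuous_compTerm_dispersion' (hν : 1 ≤ ν) :
    Continuous fun p : Fin ν → ℝ => compTerm ν (dispersion p) := by
  have hν' : (0 : ℝ) < ν := by exact_mod_cast hν
  unfold compTerm
  exact continuous_const.div (continuous_const.max (continuous_dispersion ν))
    fun p => ne_of_gt (lt_of_lt_of_le hν' (le_max_left _ _))

/-- **The fluctuation correction `u(ν)/2 = 1 - (2π)^{-ν}∫ h_ν(D)` is small**: for every `ε > 0`,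
`1 - (2π)^{-ν}∫_{[-π,π]^ν} h_ν(D(k)) d^νk ≤ ε + 1/(8εν)` — the printed Lemma A.7 ("the upper bound
in (A.6) becomes exact as `ν → ∞`", `u(ν) → 0`), obtained here from the second moment
`(2π)^{-ν}∫(D - ν)² = ν/2` instead of the Bessel-function analysis (A.38)–(A.58).
[cite: SalmhoferSeiler1991, Lemma A.7 (A.36)] -/
theorem one_sub_avgCompTerm_le_eps (hν : 1 ≤ ν) {ε : ℝ} (hε : 0 < ε) :
    1 - (∫ p in brillouin ν, compTerm ν (dispersion p)) / ((2 * π) ^ ν) ≤ ε + 1 / (8 * ε * ν) := by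
  have hν' : (0 : ℝ) < ν := by exact_mod_cast hν
  have h2π : (0 : ℝ) < (2 * π) ^ ν := by positivity
  have hB := isCompact_brillouin ν
  have hcomp : IntegrableOn (fun p : Fin ν → ℝ => compTerm ν (dispersion p)) (brillouin ν) :=
    (continuous_compTerm_dispersion' hν).continuousOn.integrableOn_compact hB
  have hone : IntegrableOn (fun _ : Fin ν → ℝ => (1 : ℝ)) (brillouin ν) :=
    continuous_const.continuousOn.integrableOn_compact hB
  have hsq : IntegrableOn (fun p : Fin ν → ℝ => (dispersion p - ν) ^ 2) (brillouin ν) :=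
    (((continuous_dispersion ν).sub continuous_const).pow 2).continuousOn.integrableOn_compact hB
  have hε_int : IntegrableOn (fun _ : Fin ν → ℝ => ε) (brillouin ν) :=
    continuous_const.continuousOn.integrableOn_compact hB
  have hrhs : IntegrableOn
      (fun p : Fin ν → ℝ => ε + (dispersion p - ν) ^ 2 / (4 * ε * (ν : ℝ) ^ 2)) (brillouin ν) :=
    hε_int.add (hsq.div_const _)
  -- integrate the pointwise bound
  have hmono : ∫ p in brillouin ν, (1 - compTerm ν (dispersion p)) ≤
      ∫ p in brillouin ν, (ε + (dispersion p - ν) ^ 2 / (4 * ε * (ν : ℝ) ^ 2)) :=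
    setIntegral_mono_on (hone.sub hcomp) hrhs (measurableSet_brillouin ν)
      fun p _ => one_sub_compTerm_le hν hε (dispersion p)
  have hvol : (volume : Measure (Fin ν → ℝ)).real (brillouin ν) = (2 * π) ^ ν := by
    have h := integral_brillouin_one (ν := ν)
    rwa [setIntegral_const, smul_eq_mul, mul_one] at h
  have hL : ∫ p in brillouin ν, (1 - compTerm ν (dispersion p)) =
      (2 * π) ^ ν - ∫ p in brillouin ν, compTerm ν (dispersion p) := by
    rw [integral_sub hone hcomp, integral_brillouin_one]
  have hR : ∫ p in brillouin ν, (ε + (dispersion p - ν) ^ 2 / (4 * ε * (ν : ℝ) ^ 2)) =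
      ε * (2 * π) ^ ν + ((ν : ℝ) / 2 * (2 * π) ^ ν) / (4 * ε * (ν : ℝ) ^ 2) := by
    rw [integral_add hε_int (hsq.div_const _), setIntegral_const, hvol, smul_eq_mul, integral_div,
      integral_brillouin_dispersion_sub_sq]
    ring
  rw [hL, hR] at hmono
  set I : ℝ := ∫ p in brillouin ν, compTerm ν (dispersion p) with hI
  have hgoal : 1 - I / (2 * π) ^ ν = ((2 * π) ^ ν - I) / (2 * π) ^ ν := by
    field_simp
  rw [hgoal, div_le_iff₀ h2π]
  calc (2 * π) ^ ν - I ≤ ε * (2 * π) ^ ν + ((ν : ℝ) / 2 * (2 * π) ^ ν) / (4 * ε * (ν : ℝ) ^ 2) :=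
        hmono
    _ = (ε + 1 / (8 * ε * ν)) * (2 * π) ^ ν := by
        field_simp
        ring

/-- **`u(ν)/2 ≤ 1/√(2ν)`**: `1 - (2π)^{-ν}∫ h_ν(D) ≤ 1/√(2ν)` (`ε = 1/(2√(2ν))` above) — the rate
`ν^{-1/2}` for the printed `u(ν) ≤ c(ν₀)ν^{-1/4}` of Lemma A.7 (A.37).
[cite: SalmhoferSeiler1991, Lemma A.7 (A.36)–(A.37)] -/
theorem one_sub_avgCompTerm_le (hν : 1 ≤ ν) :
    1 - (∫ p in brillouin ν, compTerm ν (dispersion p)) / ((2 * π) ^ ν) ≤ 1 / Real.sqrt (2 * ν) := by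
  have hν' : (0 : ℝ) < ν := by exact_mod_cast hν
  set s : ℝ := Real.sqrt (2 * ν) with hs
  have hs0 : 0 < s := Real.sqrt_pos.2 (by positivity)
  have hs2 : s ^ 2 = 2 * ν := Real.sq_sqrt (by positivity)
  have h := one_sub_avgCompTerm_le_eps hν (ε := 1 / (2 * s)) (by positivity)
  have heq : 1 / (2 * s) + 1 / (8 * (1 / (2 * s)) * ν) = 1 / s := by
    have hν2 : (ν : ℝ) = s ^ 2 / 2 := by rw [hs2]; ring
    rw [hν2]
    field_simp
    ring
  linarith

/-- `h_ν(D) ≤ 1`, so `(2π)^{-ν}∫ h_ν(D) ≤ 1` (`u(ν) ≥ 0` in Lemma A.7). [cite: SalmhoferSeiler1991, Lemma A.7 (A.36), `u(ν) ≥ 0`] -/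
theorem avgCompTerm_le_one (hν : 1 ≤ ν) :
    (∫ p in brillouin ν, compTerm ν (dispersion p)) / ((2 * π) ^ ν) ≤ 1 := by
  have hν' : (0 : ℝ) < ν := by exact_mod_cast hν
  have h2π : (0 : ℝ) < (2 * π) ^ ν := by positivity
  have hB := isCompact_brillouin ν
  have hcomp : IntegrableOn (fun p : Fin ν → ℝ => compTerm ν (dispersion p)) (brillouin ν) :=
    (continuous_compTerm_dispersion' hν).continuousOn.integrableOn_compact hB
  have hone : IntegrableOn (fun _ : Fin ν → ℝ => (1 : ℝ)) (brillouin ν) :=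
    continuous_const.continuousOn.integrableOn_compact hB
  have hle : ∫ p in brillouin ν, compTerm ν (dispersion p) ≤ ∫ _p in brillouin ν, (1 : ℝ) := by
    refine setIntegral_mono_on hcomp hone (measurableSet_brillouin ν) fun p _ => ?_
    unfold compTerm
    exact div_le_one_of_le₀ (le_max_left _ _) (le_trans hν'.le (le_max_left _ _))
  rw [integral_brillouin_one] at hle
  rwa [div_le_one h2π]

/-- **Lemma A.7, qualitative form: `(2π)^{-ν}∫ h_ν(D) → 1`** (`= ½ + νR₋(ν)`, i.e. `2νR₋(ν) → 1`,
"the upper bound in (A.6) becomes exact as `ν → ∞`"). [cite: SalmhoferSeiler1991, Lemma A.7 (A.36)] -/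
theorem tendsto_avgCompTerm :
    Tendsto (fun ν : ℕ => (∫ p in brillouin ν, compTerm ν (dispersion p)) / ((2 * π) ^ ν))
      atTop (nhds 1) := by
  have h2 : Tendsto (fun ν : ℕ => 1 - 1 / Real.sqrt (2 * ν)) atTop (nhds 1) := by
    have h : Tendsto (fun ν : ℕ => 1 / Real.sqrt (2 * ν)) atTop (nhds 0) :=
      tendsto_const_nhds.div_atTop (Real.tendsto_sqrt_atTop.comp
        (tendsto_natCast_atTop_atTop.const_mul_atTop (by norm_num : (0 : ℝ) < 2)))
    simpa using (tendsto_const_nhds (x := (1 : ℝ))).sub h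
  refine tendsto_of_tendsto_of_tendsto_of_le_of_le' h2 tendsto_const_nhds ?_ ?_
  · filter_upwards [eventually_ge_atTop 1] with ν hν
    have := one_sub_avgCompTerm_le hν
    linarith
  · filter_upwards [eventually_ge_atTop 1] with ν hν using avgCompTerm_le_one hν

/-! ### Prop. 4.2 (3): `S(ν) → 0` -/

/-- **Prop. 4.2 (3) with an explicit rate**: `S(ν) ≤ (νR(ν) - 1) + 1/√(2ν)` for `ν ≥ 3`
((A.2)–(A.3): `S = νR - ½ - νR₋ = (νR - 1) + u/2`). [cite: SalmhoferSeiler1991, Prop. 4.2 (3) with (A.59)] -/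
theorem fluctS_le_sub_one_add (hν : 3 ≤ ν) :
    fluctS ν ≤ ((ν : ℝ) * latticeGreen (0 : Site ν) - 1) + 1 / Real.sqrt (2 * ν) := by
  rw [fluctS_eq hν]
  have h := one_sub_avgCompTerm_le (ν := ν) (by omega)
  linarith

/-- **Prop. 4.2 (3), quantitative: `0 ≤ S(ν) ≤ 2/(ν - 2) + 1/√(2ν)`** (`ν ≥ 3`), from
`νR(ν) - 1 ≤ ν/(ν-2) - 1 = 2/(ν-2)` (Lemma A.4 (A.23)) and `u(ν)/2 ≤ 1/√(2ν)`; the print has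
`|S(ν)| ≤ c(ν₀)ν^{-1/4}` (4.5). [cite: SalmhoferSeiler1991, Prop. 4.2 (3) (4.5), (A.59)] -/
theorem fluctS_le_rate (hν : 3 ≤ ν) :
    fluctS ν ≤ 2 / ((ν : ℝ) - 2) + 1 / Real.sqrt (2 * ν) := by
  have h1 := fluctS_le_sub_one_add hν
  have h2 := latticeGreen_zero_le_inv_sub_two (d := ν) hν
  have hν' : (3 : ℝ) ≤ ν := by exact_mod_cast hν
  have h3 : (ν : ℝ) * latticeGreen (0 : Site ν) ≤ ν * (1 / ((ν : ℝ) - 2)) :=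
    mul_le_mul_of_nonneg_left h2 (by linarith)
  have hne : (ν : ℝ) - 2 ≠ 0 := by linarith
  have h4 : (ν : ℝ) * (1 / ((ν : ℝ) - 2)) - 1 = 2 / ((ν : ℝ) - 2) := by
    field_simp
    ring
  linarith

/-- **Prop. 4.2 (3): `S(ν) → 0` as `ν → ∞`.** [cite: SalmhoferSeiler1991, Prop. 4.2 (3)] -/
theorem tendsto_fluctS : Tendsto (fun ν : ℕ => fluctS ν) atTop (nhds 0) := by
  have h1 : Tendsto (fun ν : ℕ => 2 / ((ν : ℝ) - 2)) atTop (nhds 0) :=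
    tendsto_const_nhds.div_atTop
      (tendsto_atTop_add_const_right _ _ tendsto_natCast_atTop_atTop)
  have h2 : Tendsto (fun ν : ℕ => 1 / Real.sqrt (2 * ν)) atTop (nhds 0) :=
    tendsto_const_nhds.div_atTop (Real.tendsto_sqrt_atTop.comp
      (tendsto_natCast_atTop_atTop.const_mul_atTop (by norm_num : (0 : ℝ) < 2)))
  have hb : Tendsto (fun ν : ℕ => 2 / ((ν : ℝ) - 2) + 1 / Real.sqrt (2 * ν)) atTop (nhds 0) := by
    simpa using h1.add h2
  refine tendsto_of_tendsto_of_tendsto_of_le_of_le' tendsto_const_nhds hb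
    (Eventually.of_forall fun ν => fluctS_nonneg ν) ?_
  filter_upwards [eventually_ge_atTop 3] with ν hν using fluctS_le_rate hν

/-! ### Theorem 4.8 as printed: a dimension `ν₀` for every admissible interaction -/

/-- **Theorem 4.8 (as printed).**  "Let `N ∈ ℕ` and the interaction `W` of the complex spin system
have coefficients `w_k ≥ 0` for all `k ∈ {0, …, N}` and `w₁ = 1`.  Then there is a `ν₀ ≥ 3` so that
long-range order holds at `m = 0` for all `ν ≥ ν₀`": for `B = exp(NW)` to order `N` (`HasLog`),
`a₀ = 1`, there is `ν₀ ≥ 3` such that in every dimension `ν ≥ ν₀` there are `c > 0`, `L₀` with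
`|Λ|⁻¹∑_x⟨σ_0σ_x⟩_Λ ≥ c` for all even `L ≥ L₀` (chiral LRO at `m = 0`, uniformly in the volume).
Proof as printed: (4.42) needs `2S(ν)K(N)/N < 1`, and "`ν₀` exists because `S(ν) → 0` as `ν → ∞`
according to Proposition 4.2" (`tendsto_fluctS`, `chiralLRO_of_fluctS_lt`).
[cite: SalmhoferSeiler1991, Thm. 4.8] -/
theorem chiralLRO_exists_dim {N : ℕ} (hN : 1 ≤ N) {a w : ℕ → ℝ} (hlog : HasLog N a w)
    (ha0 : a 0 = 1) (hw1 : w 1 = 1) (hw : ∀ k, 2 ≤ k → k ≤ N → 0 ≤ w k) :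
    ∃ ν₀ : ℕ, 3 ≤ ν₀ ∧ ∀ ν : ℕ, ν₀ ≤ ν →
      ∃ c : ℝ, 0 < c ∧ ∃ L₀ : ℕ, ∀ (L : ℕ) [NeZero L], Even L → L₀ ≤ L →
        c ≤ (Fintype.card (TorusSite ν L) : ℝ)⁻¹ *
          ∑ x : TorusSite ν L, expect N 0 a
            (MvPolynomial.X (0 : TorusSite ν L) * MvPolynomial.X x) := by
  have ht : Tendsto (fun ν : ℕ => 2 * fluctS ν * sdK N w / N) atTop (nhds 0) := by
    have h := ((tendsto_fluctS.const_mul 2).mul_const (sdK N w)).div_const (N : ℝ)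
    simpa using h
  obtain ⟨ν₁, hν₁⟩ := eventually_atTop.1 (ht.eventually (gt_mem_nhds one_pos))
  refine ⟨max ν₁ 3, le_max_right _ _, fun ν hν => ?_⟩
  exact chiralLRO_of_fluctS_lt (le_trans (le_max_right _ _) hν) hN hlog ha0 hw1 hw
    (hν₁ ν (le_trans (le_max_left _ _) hν))

end ComplexSpin

end Literature.MathematicalPhysics.StatisticalMechanics

end
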